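import Mathlib
import Summits.ValiantsHypothesis.ValiantsHypothesis.Theorems.DivisionGapZeroOneTransferFaceIsolationDefs
import Summits.ValiantsHypothesis.ValiantsHypothesis.Theorems.DivisionGapZeroOneTransferStubBlockRestriction
import Summits.ValiantsHypothesis.ValiantsHypothesis.Theorems.DivisionGapZeroOneTransferMmMonomialInitialForm
import Literature.Computability.AlgebraicComplexity.ValiantClassesProofs

/-!
# Crux `DivisionGap.ZeroOneTransfer` (stmt-ValiantsHypothesis-5066), line `charged-uncharged`, Part E (lead c13) —
stub `stub_faceEngine` (E1, THE FACE ENGINE)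

For an edge predicate `E₀` on the rhombus `R_n` containing every triangular edge with both ends in the
square block `B = [r₀, r₀+m) × [c₀, c₀+m)` (`m ≥ 64` even) and such that the complement of `B` carries a
cover inside `E₀` (normal form: a fixed-point-free adjacent involution off the block, staying off the
block, along `E₀`-edges), and for any monomial `a x^u` (`a ≠ 0`), the edge-restricted dimer polynomial
`D_n[E₀] = triPMIn E₀` satisfies Valiant's bound for `D_m` up to the JSS polynomial loss:
`T^L ≤ 4 · ((n²+2)(L₊(D_n[E₀] · a x^u) + 3))^κ · (m²+1)² · (T-1)^L` for `24 L + 60 ≤ m`.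

Proof.  (1) GENERALISED BLOCK RESTRICTION (`FaceEngine.exists_smul`, the abstract form of c12's
`BlockRestriction.exists_smul` with the edge predicate added): the block substitution `blockSubst`
(`1` for first vertices off the block, `0` on pairs leaving it, the block-local variable inside) maps
`D_n[E₀]` to `c • D_m` with `c ≠ 0` the number of complement covers inside `E₀` in normal form — a cover
survives iff it maps `B` into `B`, surviving covers inside `E₀` are in bijection (restrict / glue) with
pairs (cover of `B ≅ R_m`, complement cover inside `E₀` in normal form) because block-internal edges lie
in `E₀`, and the surviving term is the `D_m`-term of the block part.  (2) `blockSubst` is a positive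
projection, hence free (`complexity_le_of_isProjection`), and `c • D_m = D_m · C c` has a unit-constant
cofactor, so Valiant's bound `monotone_lower_bound_of_coeff_zero_ne_zero` applies to `L₊(D_n[E₀])`.
(3) JSS contraction on vertex-indexed variables (`MmMonomialInitialForm.jssContraction_vtx`) and one
scalar gate (`MonomialTop.complexity_monomial_one_mul_le`) bound `L₊(D_n[E₀])` by
`((n²+2)(L₊(D_n[E₀] · a x^u) + 3))^κ`.
[cite: Valiant1980, §3 Thm 1] [cite: JuknaSeiwertSergeev2022, Lemma 2]
-/

noncomputable section

set_option linter.dupNamespace false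

namespace Summit.ValiantsHypothesis.ValiantsHypothesis.Theorems.DivisionGapZeroOneTransfer

open MvPolynomial
open Literature.Computability.AlgebraicComplexity
open Summit.ValiantsHypothesis.ValiantsHypothesis.Theorems.TriangularDimersDivisionEasy.Negative
open Summit.ValiantsHypothesis.ValiantsHypothesis.Theorems.ZeroOneTransfer
open FaceIsolation
open scoped NNReal BigOperators

namespace FaceEngine

variable {n m : ℕ} {P : Vtx n → Prop} {τ : Vtx n → Vtx m} {σ : Vtx m → Vtx n}
  {E₀ : Vtx n → Vtx n → Prop}

/-- **Counting with an edge predicate.**  For `G` = the dimer covers of `R_n` inside `E₀` mapping the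
block into itself and `C` = the complement covers inside `E₀` in normal form (identity on the block):
summing a function of the block part over `G` gives `#C •` its sum over the dimer covers of `R_m` — via
the bijection `G ≃ dimers m × C`, `f ↦ (block part, complement part)`, inverse = gluing (the glued cover
is inside `E₀` because block-internal edges are). [folklore] -/
theorem sum_good_eq_card_smul [DecidablePred P] (hσP : ∀ w, P (σ w)) (hτσ : ∀ w, τ (σ w) = w)
    (hστ : ∀ v, P v → σ (τ v) = v) (hAdj : ∀ x y, Adj (σ x) (σ y) ↔ Adj x y)
    (hE : ∀ v w, P v → P w → Adj v w → E₀ v w)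
    {G C : Finset (Vtx n → Vtx n)}
    (hG : ∀ f, f ∈ G ↔ IsDimer f ∧ (∀ v, E₀ v (f v)) ∧ ∀ v, P v → P (f v))
    (hC : ∀ h, h ∈ C ↔ ∀ v, (P v → h v = v) ∧
      (¬ P v → h (h v) = v ∧ h v ≠ v ∧ Adj v (h v) ∧ ¬ P (h v) ∧ E₀ v (h v)))
    {M : Type*} [AddCommMonoid M] (F : (Vtx m → Vtx m) → M) :
    ∑ f ∈ G, F (fun w => τ (f (σ w))) = C.card • ∑ a ∈ dimers m, F a := by
  rw [Finset.smul_sum]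
  have hc : ∀ a ∈ dimers m, C.card • F a = ∑ _h ∈ C, F a := fun a _ => by rw [Finset.sum_const]
  rw [Finset.sum_congr rfl hc, ← Finset.sum_product (dimers m) C (fun x => F x.1)]
  refine Finset.sum_nbij' (fun f => ((fun w => τ (f (σ w))), fun v => if P v then v else f v))
    (fun x => fun v => if P v then σ (x.1 (τ v)) else x.2 v)
    (fun f hf => ?_) (fun x hx => ?_) (fun f hf => ?_) (fun x hx => ?_) (fun f _ => rfl)
  · -- restriction lands in the product
    obtain ⟨hd, hE0, hg⟩ := (hG f).1 hf
    refine Finset.mem_product.2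
      ⟨BlockRestriction.restrict_mem_dimers hσP hτσ hστ hAdj hd hg, (hC _).2 fun v => ?_⟩
    refine ⟨fun hv => if_pos hv, fun hv => ?_⟩
    have hfv : ¬ P (f v) := BlockRestriction.not_mem_of_good hd hg hv
    obtain ⟨h1, h2, h3⟩ := hd v
    simp only [if_neg hv, if_neg hfv]
    exact ⟨h1, h2, h3, hfv, hE0 v⟩
  · -- gluing lands in `G`
    obtain ⟨ha, hh⟩ := Finset.mem_product.1 hx
    have hh' : ∀ v, ¬ P v → x.2 (x.2 v) = v ∧ x.2 v ≠ v ∧ Adj v (x.2 v) ∧ ¬ P (x.2 v) :=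
      fun v hv => let ⟨h1, h2, h3, h4, _⟩ := ((hC _).1 hh v).2 hv; ⟨h1, h2, h3, h4⟩
    have hdim : IsDimer (fun v => if P v then σ (x.1 (τ v)) else x.2 v) :=
      BlockRestriction.isDimer_glue hσP hτσ hστ hAdj (BlockRestriction.mem_dimers_iff.1 ha) hh'
    have hPg : ∀ v, P v → P ((fun v => if P v then σ (x.1 (τ v)) else x.2 v) v) := fun v hv => by
      simp only [if_pos hv]
      exact hσP _
    refine (hG _).2 ⟨hdim, fun v => ?_, hPg⟩
    by_cases hv : P v
    · exact hE v _ hv (hPg v hv) (hdim v).2.2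
    · simp only [if_neg hv]
      exact (((hC _).1 hh v).2 hv).2.2.2.2
  · -- glue ∘ restrict = id on `G`
    obtain ⟨-, -, hg⟩ := (hG f).1 hf
    funext v
    by_cases hv : P v
    · simp only [if_pos hv, hστ _ hv, hστ _ (hg v hv)]
    · simp only [if_neg hv]
  · -- restrict ∘ glue = id on the product
    obtain ⟨-, hh⟩ := Finset.mem_product.1 hx
    refine Prod.ext (funext fun w => ?_) (funext fun v => ?_)
    · simp only [if_pos (hσP w), hτσ]
    · by_cases hv : P v
      · simp only [if_pos hv, ((hC _).1 hh v).1 hv]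
      · simp only [if_neg hv]

/-- **Generalised block restriction, abstract form.**  For a decidable block `P` with a chart `τ` and
a parametrisation `σ` (inverse to each other on the block, `σ` transporting adjacency), an edge
predicate `E₀` containing all block-internal edges, and a complement cover inside `E₀`, the block
substitution maps `D_n[E₀]` to `c • D_m`, `c ≠ 0` the number of complement covers inside `E₀` in normal
form. [folklore] -/
theorem exists_smul (E₀ : Vtx n → Vtx n → Prop) [DecidableRel E₀] (P : Vtx n → Prop)
    [DecidablePred P] (τ : Vtx n → Vtx m) (σ : Vtx m → Vtx n)
    (hσP : ∀ w, P (σ w)) (hτσ : ∀ w, τ (σ w) = w) (hστ : ∀ v, P v → σ (τ v) = v)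
    (hAdj : ∀ x y, Adj (σ x) (σ y) ↔ Adj x y)
    (hE : ∀ v w, P v → P w → Adj v w → E₀ v w)
    (hg : ∃ g : Vtx n → Vtx n, ∀ v, ¬ P v →
      g (g v) = v ∧ g v ≠ v ∧ Adj v (g v) ∧ ¬ P (g v) ∧ E₀ v (g v)) :
    ∃ c : ℝ≥0, c ≠ 0 ∧
      MvPolynomial.aeval (fun e : Var n =>
        if P e.1 then (if P e.2 then (X (τ e.1, τ e.2) : MvPolynomial (Var m) ℝ≥0) else 0) else 1)
        (triPMIn E₀) = c • triPM m := by
  -- the surviving covers inside `E₀` and the complement covers inside `E₀` in normal form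
  set G : Finset (Vtx n → Vtx n) :=
    ((dimers n).filter fun f => ∀ v, E₀ v (f v)).filter fun f => ∀ v, P v → P (f v) with hGdef
  set C : Finset (Vtx n → Vtx n) := Finset.univ.filter fun h =>
    ∀ v, (P v → h v = v) ∧
      (¬ P v → h (h v) = v ∧ h v ≠ v ∧ Adj v (h v) ∧ ¬ P (h v) ∧ E₀ v (h v)) with hCdef
  have hG : ∀ f, f ∈ G ↔ IsDimer f ∧ (∀ v, E₀ v (f v)) ∧ ∀ v, P v → P (f v) := fun f => by
    rw [hGdef, Finset.mem_filter, mem_filter_dimers_iff, and_assoc]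
  have hC : ∀ h, h ∈ C ↔ ∀ v, (P v → h v = v) ∧
      (¬ P v → h (h v) = v ∧ h v ≠ v ∧ Adj v (h v) ∧ ¬ P (h v) ∧ E₀ v (h v)) := fun h => by
    rw [hCdef, Finset.mem_filter]
    exact ⟨fun h => h.2, fun h => ⟨Finset.mem_univ _, h⟩⟩
  -- `C` is nonempty: normalise the given complement cover to the identity on the block
  have hCpos : 0 < C.card := by
    obtain ⟨g, hg⟩ := hg
    refine Finset.card_pos.2 ⟨fun v => if P v then v else g v, (hC _).2 fun v =>
      ⟨fun hv => if_pos hv, fun hv => ?_⟩⟩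
    obtain ⟨h1, h2, h3, h4, h5⟩ := hg v hv
    simp only [if_neg hv, if_neg h4]
    exact ⟨h1, h2, h3, h4, h5⟩
  refine ⟨C.card, Nat.cast_ne_zero.2 hCpos.ne', ?_⟩
  calc MvPolynomial.aeval (fun e : Var n => if P e.1 then
          (if P e.2 then (X (τ e.1, τ e.2) : MvPolynomial (Var m) ℝ≥0) else 0) else 1) (triPMIn E₀)
      = ∑ f ∈ (dimers n).filter (fun f => ∀ v, E₀ v (f v)), ∏ v, (if P v then
          (if P (f v) then (X (τ v, τ (f v)) : MvPolynomial (Var m) ℝ≥0) else 0) else 1) := by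
        rw [triPMIn, map_sum]
        refine Finset.sum_congr rfl fun f _ => ?_
        simp only [map_prod, MvPolynomial.aeval_X]
    _ = ∑ f ∈ G, ∏ v, (if P v then
          (if P (f v) then (X (τ v, τ (f v)) : MvPolynomial (Var m) ℝ≥0) else 0) else 1) :=
        (Finset.sum_filter_of_ne fun f _ hne => not_not.1 fun h =>
          hne (BlockRestriction.prod_subst_eq_zero f h)).symm
    _ = ∑ f ∈ G, ∏ w, (X (w, τ (f (σ w))) : MvPolynomial (Var m) ℝ≥0) :=
        Finset.sum_congr rfl fun f hf =>
          BlockRestriction.prod_subst_eq hσP hτσ hστ f ((hG f).1 hf).2.2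
    _ = C.card • ∑ a ∈ dimers m, ∏ w, (X (w, a w) : MvPolynomial (Var m) ℝ≥0) :=
        sum_good_eq_card_smul hσP hτσ hστ hAdj hE hG hC
          fun a => ∏ w, (X (w, a w) : MvPolynomial (Var m) ℝ≥0)
    _ = (C.card : ℝ≥0) • triPM m := by
        rw [Nat.cast_smul_eq_nsmul]
        rfl

/-- **Generalised block restriction for the block `[r₀, r₀+m) × [c₀, c₀+m)`.**  If `E₀` contains
every triangular edge with both ends in the block and the complement of the block has a cover inside
`E₀` (in normal form), then `blockSubst` maps `D_n[E₀]` to `c • D_m` with `c ≠ 0`.  Instance of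
`exists_smul` with the chart `blockChart` (subtract the corner) and the parametrisation "add the
corner" (translation preserves the six adjacency disjuncts). [folklore] -/
theorem exists_smul_blockSubst (E₀ : Vtx n → Vtx n → Prop) [DecidableRel E₀] {r₀ c₀ m : ℕ}
    (hm : 0 < m) (hr : r₀ + m ≤ n) (hc : c₀ + m ≤ n)
    (hblk : ∀ v w : Vtx n, InBlock r₀ c₀ m v → InBlock r₀ c₀ m w → Adj v w → E₀ v w)
    (hg : ∃ g : Vtx n → Vtx n, ∀ v, ¬ InBlock r₀ c₀ m v →
        g (g v) = v ∧ g v ≠ v ∧ Adj v (g v) ∧ ¬ InBlock r₀ c₀ m (g v) ∧ E₀ v (g v)) :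
    ∃ c : ℝ≥0, c ≠ 0 ∧
      MvPolynomial.aeval (blockSubst r₀ c₀ m hm) (triPMIn E₀) = c • triPM m := by
  refine exists_smul E₀ (InBlock r₀ c₀ m) (blockChart r₀ c₀ m hm)
    (fun w : Vtx m => ((⟨r₀ + (w.1 : ℕ), by have := w.1.isLt; omega⟩ : Fin n),
      (⟨c₀ + (w.2 : ℕ), by have := w.2.isLt; omega⟩ : Fin n)))
    (fun w => ?_) (fun w => ?_) (fun v hv => ?_) (fun x y => ?_) hblk hg
  · -- the parametrisation lands in the block
    have h1 := w.1.isLt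
    have h2 := w.2.isLt
    simp only [InBlock]
    omega
  · -- chart ∘ parametrisation = id
    refine Prod.ext (Fin.ext ?_) (Fin.ext ?_)
    · show (r₀ + (w.1 : ℕ) - r₀) % m = w.1
      rw [Nat.add_sub_cancel_left, Nat.mod_eq_of_lt w.1.isLt]
    · show (c₀ + (w.2 : ℕ) - c₀) % m = w.2
      rw [Nat.add_sub_cancel_left, Nat.mod_eq_of_lt w.2.isLt]
  · -- parametrisation ∘ chart = id on the block
    obtain ⟨h1, h2, h3, h4⟩ := hv
    have e1 : ((v.1 : ℕ) - r₀) % m = (v.1 : ℕ) - r₀ := Nat.mod_eq_of_lt (by omega)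
    have e2 : ((v.2 : ℕ) - c₀) % m = (v.2 : ℕ) - c₀ := Nat.mod_eq_of_lt (by omega)
    refine Prod.ext (Fin.ext ?_) (Fin.ext ?_)
    · show r₀ + ((v.1 : ℕ) - r₀) % m = v.1
      omega
    · show c₀ + ((v.2 : ℕ) - c₀) % m = v.2
      omega
  · -- translation preserves adjacency
    simp only [Adj]
    omega

/-- `blockSubst` is a positive projection: each value is a variable, `0` or `1`. [folklore] -/
theorem blockSubst_isProj {r₀ c₀ m : ℕ} (hm : 0 < m) (e : Var n) :
    (∃ j, blockSubst r₀ c₀ m hm e = MvPolynomial.X j) ∨ ∃ c : ℝ≥0, blockSubst r₀ c₀ m hm e = C c := by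
  unfold blockSubst
  split_ifs
  · exact Or.inl ⟨_, rfl⟩
  · exact Or.inr ⟨0, by simp⟩
  · exact Or.inr ⟨1, by simp⟩

end FaceEngine

/-- **Stub E1 — THE FACE ENGINE.**  For an edge predicate `E₀` containing every triangular edge inside
the block `[r₀, r₀+m) × [c₀, c₀+m)` (`m ≥ 64` even) and admitting a cover of the block's complement
inside `E₀`, and any monomial `a·x^u` (`a ≠ 0`):
`T^L ≤ 4 · ((n²+2)(L₊(D_n[E₀] · a x^u) + 3))^κ · (m²+1)² · (T-1)^L` for `24L + 60 ≤ m` — JSS contraction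
strips the monomial, the block substitution (a positive projection) maps `D_n[E₀]` to `c • D_m`, `c ≠ 0`,
and Valiant's bound applies. [cite: Valiant1980, §3 Thm 1] [cite: JuknaSeiwertSergeev2022, Lemma 2] -/
theorem stub_faceEngine :
    ∃ κ : ℕ, ∀ (n : ℕ) (E₀ : Vtx n → Vtx n → Prop) [DecidableRel E₀] (u : Var n →₀ ℕ) (a : ℝ≥0),
      a ≠ 0 → ∀ (r₀ c₀ m : ℕ), 64 ≤ m → Even m → r₀ + m ≤ n → c₀ + m ≤ n →
      (∀ v w : Vtx n, InBlock r₀ c₀ m v → InBlock r₀ c₀ m w → Adj v w → E₀ v w) →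
      (∃ g : Vtx n → Vtx n, ∀ v, ¬ InBlock r₀ c₀ m v →
          g (g v) = v ∧ g v ≠ v ∧ Adj v (g v) ∧ ¬ InBlock r₀ c₀ m (g v) ∧ E₀ v (g v)) →
      ∀ L : ℕ, 24 * L + 60 ≤ m →
        Tfib ^ L ≤ 4 * ((n * n + 2) * (complexity (triPMIn E₀ * monomial u a) + 3)) ^ κ *
          (m * m + 1) ^ 2 * (Tfib - 1) ^ L := by
  obtain ⟨κ, hκ⟩ := MmMonomialInitialForm.jssContraction_vtx
  refine ⟨κ, fun n E₀ _ u a ha r₀ c₀ m h64 hme hr hc hblk hg L hL => ?_⟩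
  have hm : 0 < m := by omega
  -- (1) the block substitution maps `D_n[E₀]` to `c • D_m`, `c ≠ 0`
  obtain ⟨c, hc0, heq⟩ := FaceEngine.exists_smul_blockSubst E₀ hm hr hc hblk hg
  -- (2) it is a positive projection, hence free; Valiant's bound for the unit-constant cofactor `C c`
  have hproj : IsProjection (triPM m * C c) (triPMIn E₀) := by
    refine ⟨blockSubst r₀ c₀ m hm, FaceEngine.blockSubst_isProj hm, ?_⟩
    rw [heq, smul_eq_C_mul, mul_comm]
  have hcx : complexity (triPM m * C c) ≤ complexity (triPMIn E₀) :=
    complexity_le_of_isProjection hproj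
  have hC0 : coeff 0 (C c : MvPolynomial (Var m) ℝ≥0) ≠ 0 := by rwa [coeff_zero_C]
  have hval := monotone_lower_bound_of_coeff_zero_ne_zero h64 hme hL hC0
  -- (3) JSS contraction strips the monomial cofactor
  have h1 : complexity (monomial u (1 : ℝ≥0) * triPMIn E₀) ≤
      complexity (triPMIn E₀ * monomial u a) + 1 :=
    MonomialTop.complexity_monomial_one_mul_le (triPMIn E₀) u ha
  have h2 : complexity (triPMIn E₀) ≤
      ((n * n + 2) * (complexity (triPMIn E₀ * monomial u a) + 3)) ^ κ :=
    (hκ n (triPMIn E₀) u).trans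
      (Nat.pow_le_pow_left (Nat.mul_le_mul_left (n * n + 2) (by omega)) κ)
  calc Tfib ^ L ≤ 4 * complexity (triPM m * C c) * (m * m + 1) ^ 2 * (Tfib - 1) ^ L := hval
    _ ≤ 4 * ((n * n + 2) * (complexity (triPMIn E₀ * monomial u a) + 3)) ^ κ *
          (m * m + 1) ^ 2 * (Tfib - 1) ^ L := by
        apply Nat.mul_le_mul_right
        apply Nat.mul_le_mul_right
        exact Nat.mul_le_mul_left _ (hcx.trans h2)

end Summit.ValiantsHypothesis.ValiantsHypothesis.Theorems.DivisionGapZeroOneTransfer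

end
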